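import Summits.Ventures.HodgeRepro.Tier4.Line1.KernelOperator
import Summits.Ventures.HodgeRepro.Tier4.Line1.KernelUnfold

/-!
# Tier4/Line1/KernelOpEqR — LINE L1, J1 rung (1′) `kernelOp_eq_R` (t4-L1-p3)

Blind re-derivation cell `pub-hodge-repro`, Tier 4 (README §9–§10), seat t4-L1-p3.  The rung J1-(1′) of the line's
skeleton (proofs/t4-plan-1/Tier4/Line1/Skeleton-v0.11.lean L570–L572) restated byte-identically and PROVED over every
`RTF.Setting G`: on continuous `G(k)`-invariant functions the integral operator of the kernel over the fundamental
domain (`kernelOp`, t4-L1-p1's `Tier4/Line1/KernelOperator.lean`) IS the right-regular action `R(f)`.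

Proof (Mathlib only, no printed input): `(R(f)φ)(x) = ∫_G f(g) φ(xg) dg = ∫_G f(x⁻¹w) φ(w) dw` (left invariance,
`g = x⁻¹w`), then the unfolding `∫_G H = ∫_{DG} ∑_{γ ∈ G(k)} H(γw)` of `Tier4/Line1/KernelUnfold.lean`
(`integral_eq_setIntegral_tsum`, no `[Countable G(k)]`) and `φ(γw) = φ(w)` give `∫_{DG} K_f(x, w) φ(w) dw`.

Nothing here says anything about the status of the Hodge conjecture for CM abelian varieties, which is NOT proved
(HC_CM is NOT proved by anyone in this repository).
-/

set_option autoImplicit false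

noncomputable section

namespace Summit.Ventures.HodgeRepro.Tier4.Line1.RTF.Setting

open MeasureTheory Topology

variable {G : Type} [Group G] [TopologicalSpace G] [IsTopologicalGroup G] [MeasurableSpace G]
  [BorelSpace G]

variable (S : Setting G)

/-- (J1-(1′), prover-facing, M — p3's (T2) unfolding, stated once): **on continuous invariant functions the kernel
operator IS `R(f)`** (unfold `∫_G` along the finitely many rational translates of `closure DG` meeting the support — no
`[Countable Gk]`). -/
theorem kernelOp_eq_R {f : G → ℂ} (hf : IsTest f) {φ : G → ℂ} (hφ : S.Invariant φ) (hc : Continuous φ) (x : G) :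
    S.kernelOp f φ x = S.R f φ x := by
  haveI := S.haar
  have h1 : S.R f φ x = ∫ w, f (x⁻¹ * w) * φ w ∂S.μ := by
    unfold R
    have := integral_mul_left_eq_self (μ := S.μ) (fun g => f g * φ (x * g)) x⁻¹
    simp only [mul_inv_cancel_left] at this
    exact this.symm
  have hcont : Continuous (fun w => f (x⁻¹ * w) * φ w) :=
    (hf.cont.comp (continuous_const.mul continuous_id)).mul hc
  have hs : HasCompactSupport (fun w => f (x⁻¹ * w) * φ w) :=
    (hf.compact.comp_homeomorph (Homeomorph.mulLeft x⁻¹)).mul_right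
  rw [h1, S.integral_eq_setIntegral_tsum hcont hs]
  unfold kernelOp
  apply setIntegral_congr_fun₀ S.fdG.nullMeasurableSet
  intro w _
  simp only
  unfold kernel
  rw [← tsum_mul_right]
  apply tsum_congr
  intro γ
  rw [hφ γ w, mul_assoc]

end Summit.Ventures.HodgeRepro.Tier4.Line1.RTF.Setting
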